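import Mathlib.LinearAlgebra.Dual.Lemmas
import Mathlib.LinearAlgebra.PerfectPairing.Basic
import Mathlib.AlgebraicGeometry.Morphisms.ClosedImmersion
import Mathlib.AlgebraicGeometry.Morphisms.Separated
import Mathlib.AlgebraicGeometry.Morphisms.FiniteType
import Mathlib.AlgebraicGeometry.Limits
import Mathlib.RingTheory.TensorProduct.Basic
import Literature.AlgebraicGeometry.Motives.PeriodComparison
import Literature.AlgebraicGeometry.Motives.BaseChange
import Literature.AlgebraicGeometry.Motives.Varieties
import Literature.AlgebraicGeometry.Motives.AlgPoints
import Literature.AlgebraicTopology.SingularHomology.RelativeHomology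
import Literature.AlgebraicTopology.SingularHomology.CapProduct
import HarnessLib

-- D-0014 sorry-sweep (operator, 2026-08-13): sorried theorems -> named facts `def X : Prop`; partial proofs preserved in comments
-- provenance: harness21/H21/H21/Prelude/MotiveL/RelativePeriods.lean @ 217a133 (interim HEAD d8f2665); M5 mechanical rewrite
/-!
# Periods of pairs `(X, D)` (trunk MotiveL, prelude C10)

Let `k` be a field of characteristic zero and `σ : k →+* ℂ` an embedding. For a `k`-variety `X`
and a closed subvariety `D ⊆ X`, relative algebraic de Rham cohomology `Hⁱ_dR(X, D)` is a
finite-dimensional `k`-vector space, relative singular homology `Hᵢ(X_σ(ℂ), D_σ(ℂ); ℚ)` is a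
finite-dimensional `ℚ`-vector space, and integration `(ω, γ) ↦ ∫_γ ω` is a pairing
`Hⁱ_dR(X, D) × Hᵢ(X_σ(ℂ), D_σ(ℂ); ℚ) → ℂ` which becomes perfect after extending scalars to `ℂ`
(the relative version of Grothendieck's comparison theorem). Its values are the
**(cohomological) periods** of `k` (Kontsevich–Zagier, *Periods* (2001), §1.2;
Huber–Müller-Stach, *Periods and Nori motives* (2017), Ch. 3 and Def. 11.1.1 ff.); for
`k = ℚ̄` (or `k` a number field, all `σ`) they exhaust the Kontsevich–Zagier periods
(Huber–Müller-Stach 2017, Thm. 12.2.1).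

Following the two-speed design of the trunk, the relative de Rham cohomology and the period
pairing are recorded as a **hypothesis structure** `Literature.RelativePeriodData P` over an accepted
`P : PeriodRealization k` (prelude C9): a contravariant functor `Y ↦ Hⁱ(Y)` on pairs, the pairing
with the (honest, G04) relative singular homology of the complex points, perfectness after base
change, naturality, and agreement with `P.iso` composed with the G04 Kronecker pairing on pairs
`(X, ∅)` with `X` smooth projective.

## Main definitions

* `Literature.SchemePair k` : pairs `(X, D, ι : D ⟶ X)` of `k`-schemes with `ι` a closed immersion, a
  category (morphisms = commutative squares); `SchemePair.baseChange σ`, `SchemePair.ofScheme X`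
  (the pair `(X, ∅)`), `SchemePair.pointsSub`, `SchemePair.complexPointsSub Y σ = D_σ(ℂ) ⊆ X_σ(ℂ)`,
  `SchemePair.bettiHomology Y σ i = Hᵢ(X_σ(ℂ), D_σ(ℂ); ℚ)`, `SchemePair.IsVarietyPair`.
* `Literature.pairingBaseChange L p` : the `L`-bilinear extension
  `L ⊗[k] H →ₗ[L] Dual L (L ⊗[ℚ] V)` of a pairing `p : H →ₗ[k] V →ₗ[ℚ] L`.
* `Literature.RelativePeriodData P` : the hypothesis structure.
* `RelativePeriodData.cohomologicalPeriods R σ : Set ℂ`, `periodSpaceOfPair`, `periodMatrixOfPair`.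

## Design notes

* Mathlib: searched `period`, `SchemePair`, `TopPair` (Mathlib's `TopPair` is a pair of
  topological spaces, used by G04), `Arrow` (a `SchemePair` is an object of the full subcategory
  of `Arrow (SchemeOver k)` on closed immersions; we keep the field names asked for by the
  outline and give the category instance by hand), `IsClosedImmersion` (with
  `IsClosedImmersion.isStableUnderBaseChange`, used to prove `SchemePair.baseChange`), `∅ : Scheme`
  with `Scheme.emptyTo`, `LinearMap.liftBaseChange(Equiv)`, `Module.Dual.baseChange`,
  `LinearMap.IsPerfPair`. No relative de Rham cohomology or periods in Mathlib.
* Finiteness/perfectness axioms and the set of periods are restricted to pairs with `X`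
  separated of finite type over `k` (`SchemePair.IsVarietyPair`): for arbitrary `k`-schemes
  (e.g. infinite disjoint unions of points) they would be inconsistent, making the structure
  empty. Compatibility with `P.iso` is only required for smooth projective `X`, where `P`'s own
  axioms hold.
* The additivity `H(Y ⊔ Y') = H(Y) ⊕ H(Y')` and Künneth needed to make `cohomologicalPeriods` a
  `ℚ`-subalgebra of `ℂ` (Huber–Müller-Stach 2017, Prop. 11.1.7) are not fields of the structure
  and are therefore not stated.
* Universe `0` for `RelativePeriodData` (`ComplexPoints`, `PeriodRealization` force `k : Type`);
  `SchemePair` itself is universe polymorphic.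

## References

* M. Kontsevich, D. Zagier, *Periods*, in Mathematics Unlimited (2001), §1.2.
* A. Huber, S. Müller-Stach, *Periods and Nori motives*, Springer (2017), Ch. 3, §11.1, §12.2.
* A. Grothendieck, *On the de Rham cohomology of algebraic varieties*, Publ. IHÉS 29 (1966).
-/

open CategoryTheory AlgebraicGeometry Limits Opposite
open scoped TensorProduct

noncomputable section

universe u

namespace Literature.AlgebraicGeometry.Motives

/-! ### Pairs of schemes -/

/-- A **pair** `(X, D)` of `k`-schemes: a `k`-scheme `X` together with a closed `k`-immersion
`ι : D ⟶ X` (Huber–Müller-Stach 2017, Ch. 3 / §11.1: `X` a variety, `D ⊆ X` a closed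
subvariety; Kontsevich–Zagier 2001, §1.2).
[cite: HuberMullerStachPeriods2017, Ch. 3 / §11.1:  X  a variety   D ⊆ X  a] -/
structure SchemePair (k : Type u) [Field k] where
  /-- The ambient `k`-scheme `X`. -/
  X : SchemeOver k
  /-- The closed subscheme `D`. -/
  D : SchemeOver k
  /-- The inclusion `ι : D ⟶ X` over `k`. -/
  ι : D ⟶ X
  /-- `ι` is a closed immersion. -/
  isClosedImmersion : IsClosedImmersion ι.left

attribute [instance] SchemePair.isClosedImmersion

namespace SchemePair

variable {k : Type u} [Field k]

/-- A morphism of pairs `(X, D) → (X', D')`: `k`-morphisms `f_X : X ⟶ X'`, `f_D : D ⟶ D'` forming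
a commutative square with the inclusions (Huber–Müller-Stach 2017, §11.1; Hatcher 2002, §2.1,
"maps of pairs"). [cite: HuberMullerStachPeriods2017, §11.1] -/
@[ext]
structure Hom (Y Y' : SchemePair k) : Type u where
  /-- The morphism of ambient schemes. -/
  fX : Y.X ⟶ Y'.X
  /-- The morphism of closed subschemes. -/
  fD : Y.D ⟶ Y'.D
  /-- The square commutes: `f_D ≫ ι' = ι ≫ f_X`. -/
  comm : fD ≫ Y'.ι = Y.ι ≫ fX

attribute [reassoc (attr := simp)] Hom.comm

/-- Pairs of `k`-schemes form a category (Huber–Müller-Stach 2017, §11.1).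
[cite: HuberMullerStachPeriods2017, §11.1] -/
instance : Category (SchemePair k) where
  Hom := Hom
  id Y := ⟨𝟙 Y.X, 𝟙 Y.D, by simp⟩
  comp f g := ⟨f.fX ≫ g.fX, f.fD ≫ g.fD, by simp⟩
  id_comp f := Hom.ext (Category.id_comp _) (Category.id_comp _)
  comp_id f := Hom.ext (Category.comp_id _) (Category.comp_id _)
  assoc f g h := Hom.ext (Category.assoc _ _ _) (Category.assoc _ _ _)

section Category

variable {Y Y' Y'' : SchemePair k}

/-- Extensionality for morphisms of pairs. [folklore] -/
@[ext]
lemma hom_ext {f g : Y ⟶ Y'} (hX : f.fX = g.fX) (hD : f.fD = g.fD) : f = g := Hom.ext hX hD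

/-- The `X`-component of the identity is the identity. [folklore] -/
@[simp] lemma id_fX : (𝟙 Y : Y ⟶ Y).fX = 𝟙 Y.X := rfl

/-- The `D`-component of the identity is the identity. [folklore] -/
@[simp] lemma id_fD : (𝟙 Y : Y ⟶ Y).fD = 𝟙 Y.D := rfl

/-- The `X`-component of a composite. [folklore] -/
@[simp] lemma comp_fX (f : Y ⟶ Y') (g : Y' ⟶ Y'') : (f ≫ g).fX = f.fX ≫ g.fX := rfl

/-- The `D`-component of a composite. [folklore] -/
@[simp] lemma comp_fD (f : Y ⟶ Y') (g : Y' ⟶ Y'') : (f ≫ g).fD = f.fD ≫ g.fD := rfl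

end Category

/-- A pair `(X, D)` is a **pair of varieties** (in the weak sense used for periods:
Huber–Müller-Stach 2017, §11.1, conventions of Ch. 1) if `X` is separated and of finite type over
`k`; then so is the closed subscheme `D`. No reducedness or irreducibility is required.
[cite: HuberMullerStachPeriods2017, §11.1  conventions of Ch. 1] -/
structure IsVarietyPair (Y : SchemePair k) : Prop where
  /-- `X → Spec k` is separated. -/
  isSeparated : IsSeparated Y.X.hom
  /-- `X → Spec k` is locally of finite type. -/
  locallyOfFiniteType : LocallyOfFiniteType Y.X.hom
  /-- `X → Spec k` is quasi-compact. -/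
  quasiCompact : QuasiCompact Y.X.hom

/-! ### The pair `(X, ∅)` -/

variable (k) in
/-- The empty `k`-scheme `∅ → Spec k` (Mathlib `Scheme.emptyTo`). [folklore] -/
def emptyOver : SchemeOver k := Over.mk (Scheme.emptyTo (Spec (.of k)))

/-- The underlying scheme of `emptyOver k` is empty. [folklore] -/
instance : IsEmpty ↥(emptyOver k).left := inferInstanceAs (IsEmpty ↥(∅ : Scheme.{u}))

/-- The pair `(X, ∅)` attached to a `k`-scheme `X` (Huber–Müller-Stach 2017, §11.1: periods of
`X` are the periods of the pair `(X, ∅)`).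
[cite: HuberMullerStachPeriods2017, §11.1: periods of  X  are the periods of] -/
def ofScheme (X : SchemeOver k) : SchemePair k where
  X := X
  D := emptyOver k
  ι := Over.homMk (Scheme.emptyTo X.left) (Scheme.empty_ext _ _)
  isClosedImmersion := inferInstance

/-- `(ofScheme X).X = X` (by `rfl`). [folklore] -/
@[simp] lemma ofScheme_X (X : SchemeOver k) : (ofScheme X).X = X := rfl

/-- A `k`-morphism `f : X ⟶ X'` induces a morphism of pairs `(X, ∅) ⟶ (X', ∅)`. [folklore] -/
def Hom.ofScheme {X X' : SchemeOver k} (f : X ⟶ X') : ofScheme X ⟶ ofScheme X' :=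
  ⟨f, 𝟙 _, Over.OverMorphism.ext (Scheme.empty_ext _ _)⟩

/-- The `X`-component of `Hom.ofScheme f` is `f` (by `rfl`). [folklore] -/
@[simp] lemma Hom.ofScheme_fX {X X' : SchemeOver k} (f : X ⟶ X') : (Hom.ofScheme f).fX = f := rfl

/-- For `X` smooth projective, `(X, ∅)` is a pair of varieties (`X → Spec k` is proper, hence
separated and locally of finite type, and quasi-compact; Hartshorne II.4).
[cite: Hartshorne1977, Ch. II, Thm. 4.9] -/
def _root_.Literature.AlgebraicGeometry.Motives.IsSmoothProjective.isVarietyPair_ofScheme : Prop :=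
  ∀ {n : ℕ} {X : SchemeOver k} (hX : IsSmoothProjective n X),
    (ofScheme X).IsVarietyPair

/- interim proof relied on results that are now named facts (D-0014); demoted to a fact by the D-0014 sorry-sweep, proof preserved:
:=
  haveI := hX.isProper
  ⟨inferInstanceAs (IsSeparated X.hom), inferInstanceAs (LocallyOfFiniteType X.hom), hX.quasiCompact⟩
-/

open MonoidalCategory in
/-- The point `(Spec k, ∅)` is a pair of varieties. [cite: Hartshorne1977, Ch. II, Cor. 4.8(a)] -/
def isVarietyPair_ofScheme_unit : Prop :=
  (ofScheme (𝟙_ (SchemeOver k))).IsVarietyPair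

/- interim proof relied on results that are now named facts (D-0014); demoted to a fact by the D-0014 sorry-sweep, proof preserved:
:=
  (isSmoothProjective_unit (k := k)).isVarietyPair_ofScheme
-/

/-! ### Base change of pairs -/

section BaseChange

variable {L : Type u} [Field L] (σ : k →+* L)

/-- Closed immersions of `k`-schemes are stable under base change along `σ : k →+* L`: if
`ι : D ⟶ X` is a closed immersion then so is `ι_σ : D_σ ⟶ X_σ` (Stacks 01QR; Mathlib
`IsClosedImmersion.isStableUnderBaseChange`, applied to the cartesian square
`D_σ = X_σ ×_X D`). [folklore] -/
theorem isClosedImmersion_baseChangeHom_map_left {D X : SchemeOver k} (ι : D ⟶ X)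
    [IsClosedImmersion ι.left] : IsClosedImmersion ((baseChangeHom σ).map ι).left := by
  have t : IsPullback (baseChangeHomFst σ X) (pullback.snd X.hom (Spec.map (CommRingCat.ofHom σ)))
      X.hom (Spec.map (CommRingCat.ofHom σ)) :=
    IsPullback.of_hasPullback _ _
  have big : IsPullback (baseChangeHomFst σ D)
      (((baseChangeHom σ).map ι).left ≫ pullback.snd X.hom (Spec.map (CommRingCat.ofHom σ)))
      (ι.left ≫ X.hom) (Spec.map (CommRingCat.ofHom σ)) := by
    have e₁ : ((baseChangeHom σ).map ι).left ≫ pullback.snd X.hom (Spec.map (CommRingCat.ofHom σ)) =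
        pullback.snd D.hom (Spec.map (CommRingCat.ofHom σ)) :=
      pullback.lift_snd _ _ _
    rw [e₁, Over.w ι]
    exact IsPullback.of_hasPullback _ _
  exact MorphismProperty.of_isPullback
    (big.of_bot (baseChangeHom_map_left_comp_fst σ ι).symm t) ‹_›

/-- Base change of a pair along `σ : k →+* L`: `(X, D)_σ = (X_σ, D_σ)`
(Huber–Müller-Stach 2017, §11.1). [cite: HuberMullerStachPeriods2017, §11.1] -/
def baseChange (Y : SchemePair k) : SchemePair L where
  X := (baseChangeHom σ).obj Y.X
  D := (baseChangeHom σ).obj Y.D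
  ι := (baseChangeHom σ).map Y.ι
  isClosedImmersion := isClosedImmersion_baseChangeHom_map_left σ Y.ι

/-- `(Y.baseChange σ).X = (Y.X)_σ` (by `rfl`). [folklore] -/
@[simp] lemma baseChange_X (Y : SchemePair k) : (Y.baseChange σ).X = (baseChangeHom σ).obj Y.X :=
  rfl

/-- `(Y.baseChange σ).D = (Y.D)_σ` (by `rfl`). [folklore] -/
@[simp] lemma baseChange_D (Y : SchemePair k) : (Y.baseChange σ).D = (baseChangeHom σ).obj Y.D :=
  rfl

/-- `(Y.baseChange σ).ι = (Y.ι)_σ` (by `rfl`). [folklore] -/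
@[simp] lemma baseChange_ι (Y : SchemePair k) : (Y.baseChange σ).ι = (baseChangeHom σ).map Y.ι :=
  rfl

/-- Base change of a morphism of pairs along `σ`. [folklore] -/
def Hom.baseChange {Y Y' : SchemePair k} (f : Y ⟶ Y') : Y.baseChange σ ⟶ Y'.baseChange σ :=
  ⟨(baseChangeHom σ).map f.fX, (baseChangeHom σ).map f.fD, by
    change (baseChangeHom σ).map f.fD ≫ (baseChangeHom σ).map Y'.ι =
      (baseChangeHom σ).map Y.ι ≫ (baseChangeHom σ).map f.fX
    rw [← Functor.map_comp, f.comm, Functor.map_comp]⟩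

/-- The `X`-component of `f.baseChange σ` is `(f_X)_σ` (by `rfl`). [folklore] -/
@[simp] lemma Hom.baseChange_fX {Y Y' : SchemePair k} (f : Y ⟶ Y') :
    (Hom.baseChange σ f).fX = (baseChangeHom σ).map f.fX := rfl

/-- The `D`-component of `f.baseChange σ` is `(f_D)_σ` (by `rfl`). [folklore] -/
@[simp] lemma Hom.baseChange_fD {Y Y' : SchemePair k} (f : Y ⟶ Y') :
    (Hom.baseChange σ f).fD = (baseChangeHom σ).map f.fD := rfl

/-- Base change of pairs along `σ` as a functor `SchemePair k ⥤ SchemePair L`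
(Huber–Müller-Stach 2017, §11.1). [cite: HuberMullerStachPeriods2017, §11.1] -/
@[simps]
def baseChangeFunctor : SchemePair k ⥤ SchemePair L where
  obj := baseChange σ
  map := Hom.baseChange σ
  map_id _ := hom_ext ((baseChangeHom σ).map_id _) ((baseChangeHom σ).map_id _)
  map_comp _ _ := hom_ext ((baseChangeHom σ).map_comp _ _) ((baseChangeHom σ).map_comp _ _)

end BaseChange

/-! ### Points of the closed subscheme -/

section Points

variable (Y : SchemePair k) (L : Type u) [Field L] [Algebra k L]

/-- The `L`-points of `D` inside `X(L)`: the image `ι(D(L)) ⊆ X(L)` (Huber–Müller-Stach 2017,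
§11.1: the subspace `D(ℂ) ⊆ X(ℂ)`). [cite: HuberMullerStachPeriods2017, §11.1: the subspace  D(ℂ] -/
def pointsSub : Set (AlgPoints Y.X L) := Set.range (AlgPoints.map (L := L) Y.ι)

variable {Y L} in
/-- Membership in `pointsSub`, unfolded. [folklore] -/
@[simp]
lemma mem_pointsSub_iff {P : AlgPoints Y.X L} :
    P ∈ Y.pointsSub L ↔ ∃ Q : AlgPoints Y.D L, AlgPoints.map Y.ι Q = P := Iff.rfl

variable {Y} in
/-- A morphism of pairs maps `D(L)` into `D'(L)` (Hatcher 2002, §2.1, maps of pairs).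
[cite: HatcherAT2002, §2.1  maps of pairs] -/
lemma Hom.mapsTo_pointsSub {Y' : SchemePair k} (f : Y ⟶ Y') :
    Set.MapsTo (AlgPoints.map (L := L) f.fX) (Y.pointsSub L) (Y'.pointsSub L) := by
  rintro _ ⟨Q, rfl⟩
  exact ⟨AlgPoints.map f.fD Q, by rw [← AlgPoints.map_comp_apply, f.comm, AlgPoints.map_comp_apply]⟩

/-- The pair `(X, ∅)` has no points in its closed part. [folklore] -/
lemma pointsSub_ofScheme (X : SchemeOver k) : (ofScheme X).pointsSub L = ∅ := by
  refine Set.range_eq_empty_iff.mpr ⟨fun Q ↦ ?_⟩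
  have x : ↥(Spec (CommRingCat.of L)) := (⟨⊥, Ideal.isPrime_bot⟩ : PrimeSpectrum L)
  exact isEmptyElim (α := ↥(emptyOver k).left) (Q.left.base x)

end Points

/-! ### Complex points and relative Betti homology of a pair -/

section Complex

variable {k : Type} [Field k] (Y : SchemePair k) (σ : k →+* ℂ)

/-- The complex points `D_σ(ℂ) ⊆ X_σ(ℂ)` of the closed part of a pair along `σ : k →+* ℂ`
(Huber–Müller-Stach 2017, §11.1). [cite: HuberMullerStachPeriods2017, §11.1] -/
def complexPointsSub : Set (ComplexPoints (Y.baseChange σ).X) := (Y.baseChange σ).pointsSub ℂ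

/-- `complexPointsSub` is the range of `ι_σ` on complex points (by `rfl`). [folklore] -/
lemma complexPointsSub_eq :
    Y.complexPointsSub σ = Set.range (AlgPoints.map (L := ℂ) ((baseChangeHom σ).map Y.ι)) := rfl

/-- The pair `(X, ∅)` has empty closed part on complex points. [folklore] -/
@[simp]
lemma complexPointsSub_ofScheme (X : SchemeOver k) : (ofScheme X).complexPointsSub σ = ∅ := by
  refine Set.range_eq_empty_iff.mpr ⟨fun Q ↦ ?_⟩
  have x : ↥(Spec (CommRingCat.of ℂ)) := (⟨⊥, Ideal.isPrime_bot⟩ : PrimeSpectrum ℂ)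
  exact isEmptyElim (α := ↥(emptyOver k).left) ((Q.left ≫ baseChangeHomFst σ (emptyOver k)).base x)

variable {Y} in
/-- A morphism of pairs maps `D_σ(ℂ)` into `D'_σ(ℂ)`, continuously for the analytic topology
(Hatcher 2002, §2.1, maps of pairs). [cite: HatcherAT2002, §2.1  maps of pairs] -/
lemma Hom.mapsTo_complexPointsSub {Y' : SchemePair k} (f : Y ⟶ Y') :
    Set.MapsTo (AlgPoints.mapContinuous (L := ℂ) (Hom.baseChange σ f).fX) (Y.complexPointsSub σ)
      (Y'.complexPointsSub σ) :=
  (Hom.baseChange σ f).mapsTo_pointsSub ℂ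

/-- The relative Betti homology `Hᵢ(X_σ(ℂ), D_σ(ℂ); ℚ)` of a pair along `σ`: G04's
`relativeSingularHomology` of the complex points with the analytic topology
(Huber–Müller-Stach 2017, §11.1; Hatcher 2002, §2.1). [cite: HuberMullerStachPeriods2017, §11.1] -/
abbrev bettiHomology (i : ℕ) : ModuleCat.{0} ℚ :=
  Literature.AlgebraicTopology.SingularHomology.relativeSingularHomology ℚ ℚ (ComplexPoints (Y.baseChange σ).X) (Y.complexPointsSub σ) i

variable {Y} in
/-- Push-forward `f_* : Hᵢ(X_σ(ℂ), D_σ(ℂ)) ⟶ Hᵢ(X'_σ(ℂ), D'_σ(ℂ))` along a morphism of pairs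
(Hatcher 2002, §2.1). [cite: HatcherAT2002, §2.1] -/
def bettiHomology.map {Y' : SchemePair k} (f : Y ⟶ Y') (i : ℕ) :
    Y.bettiHomology σ i ⟶ Y'.bettiHomology σ i :=
  Literature.AlgebraicTopology.SingularHomology.relativeSingularHomology.map ℚ ℚ (AlgPoints.mapContinuous (L := ℂ) (Hom.baseChange σ f).fX)
    (Hom.mapsTo_complexPointsSub σ f) i

end Complex

end SchemePair

/-! ### Base change of a pairing -/

section PairingBaseChange

variable {k : Type*} [Field k] (L : Type*) [Field L] [CharZero L] [Algebra k L]
  {H : Type*} [AddCommGroup H] [Module k H] {V : Type*} [AddCommGroup V] [Module ℚ V]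

/-- The `L`-bilinear extension of a pairing `p : H × V → L` (`H` a `k`-space, `V` a `ℚ`-space,
`L ⊇ k` a field of characteristic zero) to `(L ⊗_k H) × (L ⊗_ℚ V) → L`,
`(a ⊗ ω, b ⊗ γ) ↦ a b p(ω, γ)`, as a map `L ⊗[k] H →ₗ[L] Dual_L (L ⊗[ℚ] V)` (Mathlib
`LinearMap.liftBaseChange` twice; Huber–Müller-Stach 2017, §11.1, the period isomorphism
`H_dR ⊗_k ℂ ≅ H_sing ⊗_ℚ ℂ` in pairing form).
[cite: HuberMullerStachPeriods2017, §11.1  the period isomorphism  H_dR ⊗_k] -/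
def pairingBaseChange (p : H →ₗ[k] V →ₗ[ℚ] L) : L ⊗[k] H →ₗ[L] Module.Dual L (L ⊗[ℚ] V) :=
  LinearMap.liftBaseChange L
    (((LinearMap.liftBaseChangeEquiv (M := V) (N := L) L).restrictScalars k).toLinearMap ∘ₗ p)

/-- `pairingBaseChange` on pure tensors: `(a ⊗ ω, b ⊗ γ) ↦ a • b • p ω γ`. [folklore] -/
@[simp]
lemma pairingBaseChange_tmul (p : H →ₗ[k] V →ₗ[ℚ] L) (a b : L) (ω : H) (γ : V) :
    pairingBaseChange L p (a ⊗ₜ ω) (b ⊗ₜ γ) = a • b • p ω γ := by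
  simp [pairingBaseChange]

end PairingBaseChange

/-! ### The hypothesis structure -/

/-- **Relative period data** over a period realization `P` of a field `k` of characteristic
zero: relative algebraic de Rham cohomology `Y = (X, D) ↦ Hⁱ(Y) = Hⁱ_dR(X, D)` as a
contravariant functor on pairs of `k`-schemes, together with, for every `σ : k →+* ℂ`, the
period pairing `Hⁱ(Y) × Hᵢ(X_σ(ℂ), D_σ(ℂ); ℚ) → ℂ`, `(ω, γ) ↦ ∫_γ ω`, which is natural in `Y`,
perfect after extension of scalars to `ℂ` for pairs of varieties (the relative de Rham–Betti
comparison; Huber–Müller-Stach 2017, Ch. 3, Lemma 11.1.2, and Cor. 3.3.20 for finiteness), and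
which on the pairs `(X, ∅)`, `X` smooth projective, is the pairing
`(ω, γ) ↦ ⟨P.iso σ (1 ⊗ ω), γ⟩` deduced from the comparison of `P` and the G04 Kronecker pairing
(Huber–Müller-Stach 2017, §11.1; Kontsevich–Zagier 2001, §1.2).
[cite: HuberMullerStachPeriods2017, Ch. 3  Lemma 11.1.2  and Cor. 3.3.20 for] -/
structure RelativePeriodData {k : Type} [Field k] [CharZero k] (P : PeriodRealization k) where
  /-- Relative de Rham cohomology `Hⁱ : (pairs/k)ᵒᵖ ⥤ Mod_k`. -/
  H (i : ℕ) : (SchemePair k)ᵒᵖ ⥤ ModuleCat.{0} k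
  /-- `Hⁱ(X, ∅) ≃ Hⁱ_dR(X)`: on pairs with empty closed part, `H` is the de Rham realization of
  `P` (Huber–Müller-Stach 2017, §3.1). -/
  absEquiv (X : SchemeOver k) (i : ℕ) : (H i).obj (op (SchemePair.ofScheme X)) ≃ₗ[k] P.dR.obj X i
  /-- `absEquiv` is natural in `X`. -/
  absEquiv_map : ∀ ⦃X X' : SchemeOver k⦄ (f : X ⟶ X') (i : ℕ)
    (ω : (H i).obj (op (SchemePair.ofScheme X'))),
      absEquiv X i (((H i).map (SchemePair.Hom.ofScheme f).op).hom ω) =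
        P.dR.pullback f i (absEquiv X' i ω)
  /-- `Hⁱ_dR(X, D)` is finite-dimensional for pairs of varieties (Hartshorne, *On the de Rham
  cohomology of algebraic varieties*, Publ. IHÉS 45 (1975), II Thm. 6.1; Huber–Müller-Stach 2017,
  Cor. 3.3.20). -/
  finite_H : ∀ ⦃Y : SchemePair k⦄, Y.IsVarietyPair → ∀ i : ℕ, Module.Finite k ((H i).obj (op Y))
  /-- The period pairing `Hⁱ(X, D) →ₗ[k] (Hᵢ(X_σ(ℂ), D_σ(ℂ); ℚ) →ₗ[ℚ] ℂ)`, `ω ↦ (γ ↦ ∫_γ ω)`, with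
  values in `ℂ` regarded as a `k`-algebra via `σ` (Huber–Müller-Stach 2017, Def. 11.1.1). -/
  pairing (σ : k →+* ℂ) (Y : SchemePair k) (i : ℕ) :
    (H i).obj (op Y) →ₗ[k] (Y.bettiHomology σ i →ₗ[ℚ] AlongHom ℂ σ)
  /-- The `ℂ`-bilinear extension of the period pairing of a pair of varieties is perfect
  (relative de Rham–Betti comparison: Grothendieck 1966; Huber–Müller-Stach 2017,
  Lemma 11.1.2 / Cor. 3.3.20). -/
  isPerfPair_pairingBaseChange : ∀ (σ : k →+* ℂ) ⦃Y : SchemePair k⦄, Y.IsVarietyPair →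
    ∀ i : ℕ, (pairingBaseChange (AlongHom ℂ σ) (pairing σ Y i)).IsPerfPair
  /-- Naturality of the period pairing for morphisms of pairs `f : Y ⟶ Y'`:
  `∫_γ f^*ω = ∫_{f_*γ} ω` (Huber–Müller-Stach 2017, Lemma 11.1.3 (1)). -/
  pairing_map : ∀ (σ : k →+* ℂ) ⦃Y Y' : SchemePair k⦄ (f : Y ⟶ Y') (i : ℕ)
    (ω : (H i).obj (op Y')) (γ : Y.bettiHomology σ i),
      pairing σ Y i (((H i).map f.op).hom ω) γ =
        pairing σ Y' i ω ((SchemePair.bettiHomology.map σ f i).hom γ)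
  /-- On a pair `(X, ∅)` with `X` smooth projective, the period pairing is the comparison of `P`
  followed by the Kronecker pairing: for `ω ∈ Hⁱ_dR(X)` and `γ ∈ Hᵢ(X_σ(ℂ); ℚ)`,
  `∫_γ ω = ⟨iso_σ (1 ⊗ ω), γ⟩_ℂ`, where `Hᵢ(X_σ(ℂ)) → Hᵢ(X_σ(ℂ), ∅)` is G04's `ofAbsolute` and
  `Hⁱ_B(X_σ) ≃ Hⁱ(X_σ(ℂ); ℚ)` is `P.B.isoObj` (Huber–Müller-Stach 2017, §11.1 and Lemma 11.1.2). -/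
  pairing_ofScheme : ∀ (σ : k →+* ℂ) ⦃n : ℕ⦄ ⦃X : SchemeOver k⦄, IsSmoothProjective n X →
    ∀ (i : ℕ) (ω : P.dR.obj X i)
      (γ : Literature.AlgebraicTopology.SingularHomology.singularHomology ℚ ℚ (ComplexPoints ((baseChangeHom σ).obj X)) i),
      pairing σ (SchemePair.ofScheme X) i ((absEquiv X i).symm ω)
          ((Literature.AlgebraicTopology.SingularHomology.relativeSingularHomology.ofAbsolute ℚ ℚ (ComplexPoints ((baseChangeHom σ).obj X))
            ((SchemePair.ofScheme X).complexPointsSub σ) i).hom γ) =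
        Module.Dual.baseChange (AlongHom ℂ σ)
          ((Literature.AlgebraicTopology.SingularHomology.kroneckerPairing ℚ ℚ (ComplexPoints ((baseChangeHom σ).obj X)) i).flip γ ∘ₗ
            (P.B.isoObj ((baseChangeHom σ).obj X) i).toLinearMap)
          (P.iso σ X i (1 ⊗ₜ ω))

namespace RelativePeriodData

variable {k : Type} [Field k] [CharZero k] {P : PeriodRealization k} (R : RelativePeriodData P)

/-- The `k`-vector space `Hⁱ(Y) = Hⁱ_dR(X, D)` of relative period data (Huber–Müller-Stach 2017,
§3.1). [cite: HuberMullerStachPeriods2017, §3.1] -/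
abbrev obj (Y : SchemePair k) (i : ℕ) : Type := (R.H i).obj (op Y)

/-- Pull-back `f^* : Hⁱ(Y') →ₗ Hⁱ(Y)` along a morphism of pairs (Huber–Müller-Stach 2017, §3.1).
[cite: HuberMullerStachPeriods2017, §3.1] -/
def map {Y Y' : SchemePair k} (f : Y ⟶ Y') (i : ℕ) : R.obj Y' i →ₗ[k] R.obj Y i :=
  ((R.H i).map f.op).hom

/-- `(𝟙 Y)^* = id`. [folklore] -/
@[simp]
lemma map_id (Y : SchemePair k) (i : ℕ) : R.map (𝟙 Y) i = LinearMap.id := by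
  rw [map, op_id, (R.H i).map_id]
  rfl

/-- `(f ≫ g)^* = f^* ∘ g^*`. [folklore] -/
lemma map_comp {Y Y' Y'' : SchemePair k} (f : Y ⟶ Y') (g : Y' ⟶ Y'') (i : ℕ) :
    R.map (f ≫ g) i = R.map f i ∘ₗ R.map g i := by
  rw [map, op_comp, (R.H i).map_comp]
  rfl

/-- Naturality of the pairing, restated with `map`: `∫_γ f^*ω = ∫_{f_*γ} ω`
(Huber–Müller-Stach 2017, Lemma 11.1.3 (1)). [cite: HuberMullerStachPeriods2017, Lemma 11.1.3 (1] -/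
lemma pairing_map_apply (σ : k →+* ℂ) {Y Y' : SchemePair k} (f : Y ⟶ Y') (i : ℕ)
    (ω : R.obj Y' i) (γ : Y.bettiHomology σ i) :
    R.pairing σ Y i (R.map f i ω) γ = R.pairing σ Y' i ω ((SchemePair.bettiHomology.map σ f i).hom γ) :=
  R.pairing_map σ f i ω γ

/-! ### Periods -/

section Periods

variable (σ : k →+* ℂ)

/-- The **periods of the pair** `Y = (X, D)` in degree `i` along `σ`: the complex numbers
`∫_γ ω` for `ω ∈ Hⁱ_dR(X, D)`, `γ ∈ Hᵢ(X_σ(ℂ), D_σ(ℂ); ℚ)` (Huber–Müller-Stach 2017,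
Def. 11.1.1; Kontsevich–Zagier 2001, §1.2). [cite: HuberMullerStachPeriods2017, Def. 11.1.1] -/
def periodsOfPair (Y : SchemePair k) (i : ℕ) : Set ℂ :=
  {x | ∃ (ω : R.obj Y i) (γ : Y.bettiHomology σ i), x = AlongHom.equiv σ (R.pairing σ Y i ω γ)}

/-- The **cohomological periods** of `k` along `σ`: all periods `∫_γ ω` of all pairs of
`k`-varieties `(X, D)` in all degrees (Huber–Müller-Stach 2017, Def. 11.1.1 / §11.1, the set
`𝒫(k)`; Kontsevich–Zagier 2001, §1.2).
[cite: HuberMullerStachPeriods2017, Def. 11.1.1 / §11.1  the set  𝒫(k] -/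
def cohomologicalPeriods : Set ℂ :=
  {x | ∃ (Y : SchemePair k) (_ : Y.IsVarietyPair) (i : ℕ) (ω : R.obj Y i)
    (γ : Y.bettiHomology σ i), x = AlongHom.equiv σ (R.pairing σ Y i ω γ)}

/-- The **period space** of the pair `Y` in degree `i`: the `ℚ`-subspace of `ℂ` spanned by its
periods (Huber–Müller-Stach 2017, §11.1, `𝒫⟨Hⁱ(X, D)⟩`).
[cite: HuberMullerStachPeriods2017, §11.1   𝒫⟨Hⁱ(X  D] -/
def periodSpaceOfPair (Y : SchemePair k) (i : ℕ) : Submodule ℚ ℂ :=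
  Submodule.span ℚ (R.periodsOfPair σ Y i)

variable {ι₁ ι₂ : Type*}

/-- The **period matrix** of the pair `Y` in degree `i` along `σ` with respect to a `k`-basis
`b₁` of `Hⁱ_dR(X, D)` and a `ℚ`-basis `b₂` of `Hᵢ(X_σ(ℂ), D_σ(ℂ); ℚ)`: the matrix
`(∫_{b₂ b} b₁ a)_{a, b}` (Huber–Müller-Stach 2017, §11.1 / §11.2, "period matrix";
Kontsevich–Zagier 2001, §1.2).
[cite: HuberMullerStachPeriods2017, §11.1 / §11.2  "period matrix"] -/
def periodMatrixOfPair (Y : SchemePair k) (i : ℕ) (b₁ : Module.Basis ι₁ k (R.obj Y i))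
    (b₂ : Module.Basis ι₂ ℚ (Y.bettiHomology σ i)) : Matrix ι₁ ι₂ ℂ :=
  Matrix.of fun a b ↦ AlongHom.equiv σ (R.pairing σ Y i (b₁ a) (b₂ b))

variable {σ}

/-- Membership in `periodsOfPair`, unfolded. [folklore] -/
lemma mem_periodsOfPair_iff {Y : SchemePair k} {i : ℕ} {x : ℂ} :
    x ∈ R.periodsOfPair σ Y i ↔
      ∃ (ω : R.obj Y i) (γ : Y.bettiHomology σ i), x = AlongHom.equiv σ (R.pairing σ Y i ω γ) :=
  Iff.rfl

/-- Membership in `cohomologicalPeriods`, unfolded. [folklore] -/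
lemma mem_cohomologicalPeriods_iff {x : ℂ} :
    x ∈ R.cohomologicalPeriods σ ↔ ∃ (Y : SchemePair k) (_ : Y.IsVarietyPair) (i : ℕ)
      (ω : R.obj Y i) (γ : Y.bettiHomology σ i), x = AlongHom.equiv σ (R.pairing σ Y i ω γ) :=
  Iff.rfl

/-- The periods of a pair of varieties are cohomological periods. [folklore] -/
lemma periodsOfPair_subset_cohomologicalPeriods {Y : SchemePair k} (hY : Y.IsVarietyPair)
    (i : ℕ) : R.periodsOfPair σ Y i ⊆ R.cohomologicalPeriods σ := by
  rintro x ⟨ω, γ, rfl⟩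
  exact ⟨Y, hY, i, ω, γ, rfl⟩

/-- `0` is a period of every pair (take `ω = 0`). [folklore] -/
lemma zero_mem_periodsOfPair (Y : SchemePair k) (i : ℕ) : (0 : ℂ) ∈ R.periodsOfPair σ Y i :=
  ⟨0, 0, by simp⟩

/-- The period space of a pair of varieties is contained in the `ℚ`-span of the cohomological
periods. [folklore] -/
lemma periodSpaceOfPair_le_span {Y : SchemePair k} (hY : Y.IsVarietyPair) (i : ℕ) :
    R.periodSpaceOfPair σ Y i ≤ Submodule.span ℚ (R.cohomologicalPeriods σ) :=
  Submodule.span_mono (R.periodsOfPair_subset_cohomologicalPeriods hY i)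

/-- The entries of a period matrix are periods of the pair. [folklore] -/
lemma periodMatrixOfPair_mem_periodsOfPair (Y : SchemePair k) (i : ℕ)
    (b₁ : Module.Basis ι₁ k (R.obj Y i)) (b₂ : Module.Basis ι₂ ℚ (Y.bettiHomology σ i))
    (a : ι₁) (b : ι₂) : R.periodMatrixOfPair σ Y i b₁ b₂ a b ∈ R.periodsOfPair σ Y i :=
  ⟨b₁ a, b₂ b, rfl⟩

/-- Pull-back does not create new periods: the periods of `f^*ω` on `Y` are periods of `ω` on
`Y'` (naturality, Huber–Müller-Stach 2017, Lemma 11.1.3 (1)).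
[cite: HuberMullerStachPeriods2017, Lemma 11.1.3 (1] -/
lemma pairing_map_mem_periodsOfPair {Y Y' : SchemePair k} (f : Y ⟶ Y') (i : ℕ) (ω : R.obj Y' i)
    (γ : Y.bettiHomology σ i) :
    AlongHom.equiv σ (R.pairing σ Y i (R.map f i ω) γ) ∈ R.periodsOfPair σ Y' i :=
  ⟨ω, (SchemePair.bettiHomology.map σ f i).hom γ, by rw [pairing_map_apply]⟩

variable (σ) in
/-- Every rational number is a cohomological period: `q = ∫_γ 1` on the pair `(Spec k, ∅)` for
`γ = q · [pt] ∈ H₀(pt; ℚ)` (Huber–Müller-Stach 2017, §11.1; from `pairing_ofScheme`,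
`P.iso_one`, `P.B.iso_one` and the evaluation formula `kroneckerPairing_π_single`).
[cite: HuberMullerStachPeriods2017, §11.1] -/
def ratCast_mem_cohomologicalPeriods : Prop :=
  ∀ (q : ℚ),
    (q : ℂ) ∈ R.cohomologicalPeriods σ

variable (σ) in
/-- The periods of a smooth projective `X` along `σ` in the sense of `P` (prelude C9,
`P.periodSetOf σ X i`) are periods of the pair `(X, ∅)`: both are the numbers
`φ_ℂ(iso_σ(1 ⊗ ω))`, and by `pairing_ofScheme` with universal coefficients
(`isPerfPair_kroneckerPairing_of_field`) every `φ ∈ Hⁱ_B(X_σ)^∨` is `⟨-, γ⟩` for some `γ`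
(Huber–Müller-Stach 2017, §11.1). [cite: HuberMullerStachPeriods2017, §11.1] -/
def periodSetOf_subset_periodsOfPair : Prop :=
  ∀ {n : ℕ} {X : SchemeOver k} (hX : IsSmoothProjective n X) (i : ℕ),
    P.periodSetOf σ X i ⊆ R.periodsOfPair σ (SchemePair.ofScheme X) i

end Periods

end RelativePeriodData

end Literature.AlgebraicGeometry.Motives

end
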